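import Mathlib
import HarnessLib
import Summits.HubbardSuperconductivity.HubbardSuperconductivity.Theorems.KLProgrammeKLRegimeSplitPredicates

/-!
# Route `KLProgramme` — the four CLOSED child `Prop`s of the glued split of crux K3 `KLRegimeTwoPointLimit`
# (stmt-HubbardSuperconductivity-19937) and the glue `klRegime_induction`, PROVED.  Part 3 of 3 (seat p2, owner;
# DECOMP v7.2 §8 (i) S1–S3, plan g8 2026-08-26T04:10:52Z; children to be filed by kl-plan with `route edit --split`).

The children are CONDITIONAL STEP statements over the per-scale predicates of Parts 1–2 (`BetaSplitAt`, `RenormalisedAt`,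
`EngineBoundsAt`, `TwoLegStepAt`, `FrameOK`), on the ANALYSIS WINDOW `μ ∈ [-1, -0.15]` (`klWindow`; so that the glue reaches
the registered stub statement `KLRegimeAnalysisWindow = KLRegimeTwoPointLimitMu (-1) (-0.15)` of the birth skeleton, restated
here as `KLRegimeTwoPointLimitMu` because this module must not import the route file), in the KL regime
`klBetaMin ≤ β ≤ exp(c/U²)`, `0 < U ≤ U₀`, at every scale `n ≤ n_β = klTempScaleIdx β klE0` with the side condition
`IsKLRegime U c (-n)` (p2 g2) carried as a hypothesis (it follows from `β ≤ exp(c/U²)`: `isKLRegime_of_le_tempScaleIdx`).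
Constants are threaded in the order `G → P → Q → (R, c) → U₀` (Part 1's module doc) so that the glue composes:

* `KLRegimeEngine` (child 3, rank 2 — C5b + the CT-scheme half of C4a):
  `∃ G, ∀ P, ∃ Q, ∀ R c, ∃ U₀, ∀ (data) K, FrameOK → ∀ n ≤ n_β, (∀ j < n, BetaSplitAt j ∧ RenormalisedAt j) →
  EngineBoundsAt n ∧ TwoLegStepAt n` — the fermionic tree expansion for OUR action, one scale.
* `KLRegimeBetaSplit` (child 1, rank 3 — C1 / E.4): `∀ G, ∃ P, ∀ Q, ∃ c₀, ∀ c ≤ c₀, ∀ R, ∃ U₀ L₁, … ∀ n ≤ n_β,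
  (∀ j < n, BetaSplitAt j ∧ RenormalisedAt j) → EngineBoundsAt n → BetaSplitAt n` — one cascade step in C2's envelopes plus
  freezing (E.1/E.3); `c₀` is where `β ≤ exp(c/U²)` is spent (no onset).
* `KLRegimeCounterterm` (child 2, rank 4 — C4 inversion in the CT scheme): `∀ G P Q, ∃ R c₁, ∀ c ≤ c₁, ∃ U₀ L₂ M₂, …,
  (∀ K, FrameOK K → ∀ n ≤ n_β, (∀ j < n, RenormalisedAt K j) → EngineBoundsAt n ∧ TwoLegStepAt n ∧ BetaSplitAt n) →
  ∃ K, FrameOK K ∧ ∀ n ≤ n_β, RenormalisedAt K n` — successive approximation of the counterterm from the engine's two-leg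
  output (sizes, tangential floor, Lipschitz); the hypothesis is exactly what the glue's strong induction makes of children 3+1.
* `KLRegimeTwoPointAssembly` (child 4, rank 5 — BGM §2.4 / Lemmas 2.4–2.5 role): `∀ G P Q R c, ∃ U₀, ∀ (μ U β) L⋆ M⋆,
  (∀ L ≥ L⋆, ∀ M ≥ M⋆ L, ∃ K, FrameOK K ∧ ∀ n ≤ n_β, all four predicates at n) → the two-point limit at (β, U, μ)`.
* GLUE `klRegime_induction : KLRegimeEngine → KLRegimeBetaSplit → KLRegimeCounterterm → KLRegimeTwoPointAssembly →
  KLRegimeTwoPointLimitMu (-1) (-0.15)`, PROVED (constants picked in order, strong induction on `n`, thresholds maxed);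
  with S0 `MuOfDopingWindow` this is `KLRegimeTwoPointLimit` (the birth skeleton's `KLRegimeTwoPointLimit_of`, verbatim).

Nothing here asserts anything about the Hubbard model: four `Prop`s and an implication between them.
References: HOME/DECOMP.md v7.2 §8 (i); BGM 2006 [arXiv:cond-mat/0507686] Thm 2.1, §2.4, §3; FST, CPAM 53 (2000) 1350.
-/

noncomputable section

namespace Summit.HubbardSuperconductivity.HubbardSuperconductivity.Theorems.KLRegimeSplit

set_option linter.dupNamespace false -- summit = problem name (single-conjunct summit), D-0017

open Real Finset Filter Literature.MathematicalPhysics.QuantumLattice Literature.Probability.LatticeModels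
open Literature.MathematicalPhysics.QuantumLattice.FermiRG
open Summit.HubbardSuperconductivity.HubbardSuperconductivity.Theorems.KLProgrammeLegKernels
open Summit.HubbardSuperconductivity.HubbardSuperconductivity.Theorems.DispersionFlow

/-! ## §1 The target in the `μ`-parametrisation and the regime -/

/-- **K3 in the `μ`-parametrisation on the window `[μa, μb]`** (verbatim the birth skeleton's `KLRegimeTwoPointLimitMu`;
`KLRegimeAnalysisWindow` is the instance `(-1, -0.15)`): for every `a > 0` the two-point thermodynamic limit in the KL regime
`e^{a/U} ≤ β ≤ e^{c/U²}`, constants uniform on the window. -/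
def KLRegimeTwoPointLimitMu (μa μb : ℝ) : Prop :=
  ∀ a : ℝ, 0 < a → ∃ U₀ c : ℝ, 0 < U₀ ∧ 0 < c ∧
    ∀ μ ∈ Set.Icc μa μb, ∀ U β : ℝ, 0 < U → U ≤ U₀ → Real.exp (a / U) ≤ β → β ≤ Real.exp (c / U ^ 2) →
      ∀ (x y : Site 2) (σ σ' : Fin 2), ∃ S : ℂ,
        Tendsto (fun L : ℕ => hubbardThermalTwoPoint β U μ L x y σ σ') atTop (nhds S)

/-- **The least inverse temperature of the multiscale regime**, FIXED: `β ≥ 128` (so `π/β < e₀ = 1/32`: the temperature sits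
below the UV end of the infrared region).  K3's own regime `β ≥ e^{a/U}` implies it once `U₀ ≤ a / log 128` (glue). -/
def klBetaMin : ℝ := 128

/-- The number of scales `n_β = klTempScaleIdx β klE0` (D1). -/
abbrev nScales (β : ℝ) : ℕ := klTempScaleIdx β klE0

section Children

/-! ## §2 The four children (closed `Prop`s) -/

/-- **Child 3 `KLRegimeEngine` (rank 2; DECOMP C5b + C4a's two-leg output in the CT scheme).**  There are absolute constants `G`
such that for every choice `P` of the flow's induction constants there are engine constants `Q` such that for every
renormalisation package `R` and every regime constant `c > 0` there is `U₀ > 0` with: for `μ` in the analysis window,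
`0 < U ≤ U₀`, `klBetaMin ≤ β ≤ e^{c/U²}`, `L ≥ Q.L0 β`, `M ≥ Q.M0 β L`, every ADMISSIBLE frame `K` (`FrameOK`) and every scale
`n ≤ n_β` in the KL regime: IF the split (`BetaSplitAt`) and the renormalisation of the frame (`RenormalisedAt`) hold at
all scales `j < n`, THEN the scale-`n` kernel bounds `EngineBoundsAt n` and the two-leg step `TwoLegStepAt n` hold — the
`n!`-free fermionic tree expansion with anisotropic sectors for OUR action (BGM 2006 Thm 2.1's role with `|U||h| ≤ c₀` replaced
by the split; App. D U1–U7), one scale at a time. -/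
def KLRegimeEngine : Prop :=
  ∃ G : GeoConsts, G.WF ∧ ∀ P : SplitConsts, P.WF → ∃ Q : EngConsts, Q.WF ∧ ∀ R : RenConsts, R.WF → ∀ c : ℝ, 0 < c →
    ∃ U₀ : ℝ, 0 < U₀ ∧ ∀ μ ∈ klWindow, ∀ U : ℝ, 0 < U → U ≤ U₀ → ∀ β : ℝ, klBetaMin ≤ β → β ≤ Real.exp (c / U ^ 2) →
      ∀ (L M : ℕ) [NeZero L] [NeZero M], Q.L0 β ≤ L → Q.M0 β L ≤ M →
        ∀ K : TrigPolyC4v, FrameOK R U (nScales β) μ K →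
          ∀ n : ℕ, n ≤ nScales β → IsKLRegime U c (-(n : ℤ)) →
            (∀ j < n, BetaSplitAt L M G P Q β U μ K j ∧ RenormalisedAt L M β U μ K R j) →
              EngineBoundsAt L M G P Q β U μ K n ∧ TwoLegStepAt L M G P Q R β U μ K n

/-- **Child 1 `KLRegimeBetaSplit` (rank 3; DECOMP C1 = Lemma E.4 as ONE cascade step).**  For all absolute constants `G` there are
induction constants `P` such that for all engine constants `Q` there is `c₀ > 0` (no onset: where `β ≤ e^{c/U²}` is spent) such
that for every `0 < c ≤ c₀` and every `R` there are `U₀ > 0` and a volume threshold `L₁` with: in the regime, for every admissible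
frame and every scale `n ≤ n_β`: the split and the renormalisation at the scales `< n` together with the engine's scale-`n`
output give the split AT scale `n` — the Cooper blocks stay in C2's Riccati envelopes (`attractiveEnvelope_step` /
`repulsiveEnvelope_step` on (E2)), the endpoint line and the first moments are restored, the non-Cooper tuples are frozen
((E2′) summed with `G`'s freezing bounds = Lemma E.1/E.3). -/
def KLRegimeBetaSplit : Prop :=
  ∀ G : GeoConsts, G.WF → ∃ P : SplitConsts, P.WF ∧ ∀ Q : EngConsts, Q.WF → ∃ c₀ : ℝ, 0 < c₀ ∧
    ∀ c : ℝ, 0 < c → c ≤ c₀ → ∀ R : RenConsts, R.WF → ∃ U₀ : ℝ, 0 < U₀ ∧ ∃ L₁ : ℝ → ℝ → ℕ,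
      ∀ μ ∈ klWindow, ∀ U : ℝ, 0 < U → U ≤ U₀ → ∀ β : ℝ, klBetaMin ≤ β → β ≤ Real.exp (c / U ^ 2) →
        ∀ (L M : ℕ) [NeZero L] [NeZero M], Q.L0 β ≤ L → L₁ β U ≤ L → Q.M0 β L ≤ M →
          ∀ K : TrigPolyC4v, FrameOK R U (nScales β) μ K →
            ∀ n : ℕ, n ≤ nScales β → IsKLRegime U c (-(n : ℤ)) →
              (∀ j < n, BetaSplitAt L M G P Q β U μ K j ∧ RenormalisedAt L M β U μ K R j) →
                EngineBoundsAt L M G P Q β U μ K n → BetaSplitAt L M G P Q β U μ K n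

/-- **Child 2 `KLRegimeCounterterm` (rank 4; DECOMP C4 in the counterterm scheme = FST's inversion by successive approximation).**
For all `G, P, Q` there are a renormalisation package `R` and `c₁ > 0` such that for every `0 < c ≤ c₁` there are `U₀ > 0` and
thresholds `L₂, M₂` with: in the regime, IF for every admissible frame `K` renormalised down to the scales `< n` the engine's
output, the two-leg step and the split hold at scale `n` (all `n ≤ n_β` — exactly what the glue's induction makes of children
3 and 1), THEN there is an admissible frame `K` renormalised down to EVERY scale `n ≤ n_β`: the counterterm map
`K ↦ -Σ_n ℓ_n(K)` maps the frame ball into itself (sizes + tangential floor of (E3), p2 g2's `GeomConstants.of_perturbation`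
and the analysis-window geometry) and is a contraction (Lipschitz clause of (E3)). -/
def KLRegimeCounterterm : Prop :=
  ∀ G : GeoConsts, ∀ P : SplitConsts, ∀ Q : EngConsts, G.WF → P.WF → Q.WF →
    ∃ R : RenConsts, R.WF ∧ ∃ c₁ : ℝ, 0 < c₁ ∧ ∀ c : ℝ, 0 < c → c ≤ c₁ →
      ∃ U₀ : ℝ, 0 < U₀ ∧ ∃ L₂ : ℝ → ℝ → ℕ, ∃ M₂ : ℝ → ℕ → ℕ,
        ∀ μ ∈ klWindow, ∀ U : ℝ, 0 < U → U ≤ U₀ → ∀ β : ℝ, klBetaMin ≤ β → β ≤ Real.exp (c / U ^ 2) →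
          ∀ (L M : ℕ) [NeZero L] [NeZero M], L₂ β U ≤ L → M₂ β L ≤ M →
            (∀ K : TrigPolyC4v, FrameOK R U (nScales β) μ K →
              ∀ n : ℕ, n ≤ nScales β → IsKLRegime U c (-(n : ℤ)) →
                (∀ j < n, RenormalisedAt L M β U μ K R j) →
                  EngineBoundsAt L M G P Q β U μ K n ∧ TwoLegStepAt L M G P Q R β U μ K n ∧
                    BetaSplitAt L M G P Q β U μ K n) →
            ∃ K : TrigPolyC4v, FrameOK R U (nScales β) μ K ∧ ∀ n : ℕ, n ≤ nScales β → RenormalisedAt L M β U μ K R n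

/-- **Child 4 `KLRegimeTwoPointAssembly` (rank 5; BGM 2006 §2.4 / Lemmas 2.4–2.5 for the last scales with an `O(1)` Cooper block).**
For all constants and every regime constant `c > 0` there is `U₀ > 0` with: in the regime at `(μ, U, β)`, IF beyond some volume /
Matsubara thresholds there is, for every `(L, M)`, an admissible frame renormalised, split, engine-bounded and two-leg-controlled
at every scale `n ≤ n_β`, THEN the finite-volume equal-time thermal two-point functions of the Hubbard torus at `(β, U, μ)`
converge as `L → ∞` (uniform-in-`L` bounds ⇒ the limit; `M → ∞` first, tree `HubbardThermalTwoPointMatsubaraLimit`). -/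
def KLRegimeTwoPointAssembly : Prop :=
  ∀ G : GeoConsts, ∀ P : SplitConsts, ∀ Q : EngConsts, ∀ R : RenConsts, G.WF → P.WF → Q.WF → R.WF →
    ∀ c : ℝ, 0 < c → ∃ U₀ : ℝ, 0 < U₀ ∧
      ∀ μ ∈ klWindow, ∀ U : ℝ, 0 < U → U ≤ U₀ → ∀ β : ℝ, klBetaMin ≤ β → β ≤ Real.exp (c / U ^ 2) →
        ∀ (Lstar : ℕ) (Mstar : ℕ → ℕ),
          (∀ (L M : ℕ) [NeZero L] [NeZero M], Lstar ≤ L → Mstar L ≤ M →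
            ∃ K : TrigPolyC4v, FrameOK R U (nScales β) μ K ∧ ∀ n : ℕ, n ≤ nScales β →
              RenormalisedAt L M β U μ K R n ∧ BetaSplitAt L M G P Q β U μ K n ∧
                EngineBoundsAt L M G P Q β U μ K n ∧ TwoLegStepAt L M G P Q R β U μ K n) →
          ∀ (x y : Site 2) (σ σ' : Fin 2), ∃ S : ℂ,
            Tendsto (fun L : ℕ => hubbardThermalTwoPoint β U μ L x y σ σ') atTop (nhds S)

end Children

/-! ## §3 The KL side condition follows from the regime -/

/-- `e₀/π ≤ 1`. -/
theorem klE0_div_pi_le_one : klE0 / Real.pi ≤ 1 := by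
  rw [div_le_one Real.pi_pos, klE0]
  linarith [Real.pi_gt_three]

/-- **In the regime `β ≤ e^{c/U²}` every scale `n ≤ n_β` is a KL-regime scale**: `U²·n·log 4 ≤ c`
(`n ≤ n_β = ⌊log₄(e₀β/π)⌋ ≤ log₄ β ≤ c/(U² log 4)`). -/
theorem isKLRegime_of_le_tempScaleIdx {U c β : ℝ} {n : ℕ} (hc : 0 ≤ c) (hβ : 0 < β)
    (hβc : β ≤ Real.exp (c / U ^ 2)) (hn : n ≤ nScales β) : IsKLRegime U c (-(n : ℤ)) := by
  unfold IsKLRegime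
  have habs : |((-(n : ℤ) : ℤ) : ℝ)| = (n : ℝ) := by
    rw [Int.cast_neg, Int.cast_natCast, abs_neg, Nat.abs_cast]
  rw [habs]
  have hlog4 : 0 < Real.log 4 := Real.log_pos (by norm_num)
  have hU2 : 0 ≤ U ^ 2 := sq_nonneg U
  rcases Nat.eq_zero_or_pos n with h0 | hpos
  · subst h0; simp; exact hc
  · -- `n ≥ 1` forces the floor argument to be `≥ 0`, hence `n ≤ log₄ (e₀ β / π)`
    set y : ℝ := Real.logb 4 (klE0 * β / Real.pi) with hy
    have hn' : (n : ℝ) ≤ y := by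
      by_cases hy0 : 0 ≤ y
      · exact le_trans (by exact_mod_cast hn) (Nat.floor_le hy0)
      · exfalso
        have : nScales β = 0 := Nat.floor_of_nonpos (le_of_lt (not_le.mp hy0))
        omega
    have hx : 0 < klE0 * β / Real.pi := by unfold klE0; positivity
    have hxβ : klE0 * β / Real.pi ≤ β := by
      rw [mul_div_right_comm]
      exact mul_le_of_le_one_left hβ.le klE0_div_pi_le_one
    -- `n log 4 ≤ log (e₀β/π) ≤ log β ≤ c / U²`
    have h1 : (n : ℝ) * Real.log 4 ≤ Real.log (klE0 * β / Real.pi) := by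
      have : y * Real.log 4 = Real.log (klE0 * β / Real.pi) := by
        rw [hy, Real.logb, div_mul_cancel₀ _ hlog4.ne']
      rw [← this]
      exact mul_le_mul_of_nonneg_right hn' hlog4.le
    have h2 : Real.log (klE0 * β / Real.pi) ≤ Real.log β := Real.log_le_log hx hxβ
    have h3 : Real.log β ≤ c / U ^ 2 := by
      have := Real.log_le_log hβ hβc
      rwa [Real.log_exp] at this
    have h4 : (n : ℝ) * Real.log 4 ≤ c / U ^ 2 := h1.trans (h2.trans h3)
    by_cases hU : U = 0
    · subst hU; simp; exact hc
    · have hU2' : 0 < U ^ 2 := by positivity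
      rw [le_div_iff₀ hU2'] at h4
      linarith [h4]

/-- `β ≥ klBetaMin` is positive. -/
theorem pos_of_klBetaMin_le {β : ℝ} (h : klBetaMin ≤ β) : 0 < β := lt_of_lt_of_le (by norm_num [klBetaMin]) h

/-- **K3's own regime implies the multiscale regime**: if `U₀ ≤ a / log 128` and `0 < U ≤ U₀` then `e^{a/U} ≥ 128`. -/
theorem klBetaMin_le_of_exp_le {a U U₀ β : ℝ} (hU : 0 < U) (hUle : U ≤ U₀)
    (hU₀ : U₀ ≤ a / Real.log klBetaMin) (hβ : Real.exp (a / U) ≤ β) : klBetaMin ≤ β := by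
  have hlog : 0 < Real.log klBetaMin := Real.log_pos (by norm_num [klBetaMin])
  have h1 : Real.log klBetaMin ≤ a / U := by
    rw [le_div_iff₀ hU]
    have : U * Real.log klBetaMin ≤ U₀ * Real.log klBetaMin := mul_le_mul_of_nonneg_right hUle hlog.le
    have h' : U₀ * Real.log klBetaMin ≤ a := by rwa [le_div_iff₀ hlog] at hU₀
    linarith
  calc klBetaMin = Real.exp (Real.log klBetaMin) := (Real.exp_log (by norm_num [klBetaMin])).symm
    _ ≤ Real.exp (a / U) := Real.exp_le_exp.mpr h1
    _ ≤ β := hβ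

/-! ## §4 The glue: downward (strong) induction on the scales, the counterterm, the assembly -/

/-- **The glued induction over the scales (children 3 + 1)**: for fixed data and an admissible frame `K`, if the frame is
renormalised at every scale below `n`, then the engine bounds, the two-leg step and the split hold at every scale `≤ n`. -/
theorem allScales_of_steps {L M : ℕ} [NeZero L] [NeZero M] {G : GeoConsts} {P : SplitConsts} {Q : EngConsts}
    {R : RenConsts} {β U μ : ℝ} {K : TrigPolyC4v} {N : ℕ} {KL : ℕ → Prop}
    (hE : ∀ n ≤ N, KL n → (∀ j < n, BetaSplitAt L M G P Q β U μ K j ∧ RenormalisedAt L M β U μ K R j) →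
      EngineBoundsAt L M G P Q β U μ K n ∧ TwoLegStepAt L M G P Q R β U μ K n)
    (hB : ∀ n ≤ N, KL n → (∀ j < n, BetaSplitAt L M G P Q β U μ K j ∧ RenormalisedAt L M β U μ K R j) →
      EngineBoundsAt L M G P Q β U μ K n → BetaSplitAt L M G P Q β U μ K n)
    (hKL : ∀ n ≤ N, KL n) :
    ∀ n ≤ N, (∀ j < n, RenormalisedAt L M β U μ K R j) →
      EngineBoundsAt L M G P Q β U μ K n ∧ TwoLegStepAt L M G P Q R β U μ K n ∧ BetaSplitAt L M G P Q β U μ K n := by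
  intro n
  induction n using Nat.strong_induction_on with
  | _ n ih =>
    intro hn hR
    have hyp : ∀ j < n, BetaSplitAt L M G P Q β U μ K j ∧ RenormalisedAt L M β U μ K R j := fun j hj =>
      ⟨(ih j hj (le_of_lt (lt_of_lt_of_le hj hn)) fun i hi => hR i (hi.trans hj)).2.2, hR j hj⟩
    have h1 := hE n hn (hKL n hn) hyp
    exact ⟨h1.1, h1.2, hB n hn (hKL n hn) hyp h1.1⟩

/-- **GLUE (the support item `KLRegimeInduction` of the split, proved): the four children give K3 on the analysis window**
`KLRegimeTwoPointLimitMu (-1) (-0.15)` (= the registered stub `KLRegimeAnalysisWindow`; with S0 `MuOfDopingWindow` the crux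
`KLRegimeTwoPointLimit` follows by the birth skeleton's composition `KLRegimeTwoPointLimit_of`).  Order of choices:
`G` (child 3) → `P` (child 1) → `Q` (child 3) → `c₀` (child 1), `(R, c₁)` (child 2) → `c = min c₀ c₁` → the four `U₀`'s and
`a / log 128` → thresholds maxed per `(β, U)`; then the strong induction `allScales_of_steps`, child 2's frame, child 4. -/
theorem klRegime_induction (h₃ : KLRegimeEngine) (h₁ : KLRegimeBetaSplit) (h₂ : KLRegimeCounterterm)
    (h₄ : KLRegimeTwoPointAssembly) : KLRegimeTwoPointLimitMu (-1) (-0.15) := by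
  intro a ha
  obtain ⟨G, hG, h₃P⟩ := h₃
  obtain ⟨P, hP, h₁Q⟩ := h₁ G hG
  obtain ⟨Q, hQ, h₃R⟩ := h₃P P hP
  obtain ⟨c₀, hc₀, h₁c⟩ := h₁Q Q hQ
  obtain ⟨R, hR, c₁, hc₁, h₂c⟩ := h₂ G P Q hG hP hQ
  set c : ℝ := min c₀ c₁ with hc_def
  have hc : 0 < c := lt_min hc₀ hc₁
  obtain ⟨U₃, hU₃, h₃main⟩ := h₃R R hR c hc
  obtain ⟨U₁, hU₁, L₁, h₁main⟩ := h₁c c hc (min_le_left _ _) R hR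
  obtain ⟨U₂, hU₂, L₂, M₂, h₂main⟩ := h₂c c hc (min_le_right _ _)
  obtain ⟨U₄, hU₄, h₄main⟩ := h₄ G P Q R hG hP hQ hR c hc
  have hlog : 0 < Real.log klBetaMin := Real.log_pos (by norm_num [klBetaMin])
  set U₀ : ℝ := min (min (min U₁ U₂) (min U₃ U₄)) (a / Real.log klBetaMin) with hU₀_def
  have hU₀ : 0 < U₀ := lt_min (lt_min (lt_min hU₁ hU₂) (lt_min hU₃ hU₄)) (div_pos ha hlog)
  refine ⟨U₀, c, hU₀, hc, ?_⟩
  intro μ hμ U β hU hUle hβa hβc x y σ σ'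
  have hμ' : μ ∈ klWindow := hμ
  have hU1 : U ≤ U₁ := hUle.trans ((min_le_left _ _).trans ((min_le_left _ _).trans (min_le_left _ _)))
  have hU2 : U ≤ U₂ := hUle.trans ((min_le_left _ _).trans ((min_le_left _ _).trans (min_le_right _ _)))
  have hU3 : U ≤ U₃ := hUle.trans ((min_le_left _ _).trans ((min_le_right _ _).trans (min_le_left _ _)))
  have hU4 : U ≤ U₄ := hUle.trans ((min_le_left _ _).trans ((min_le_right _ _).trans (min_le_right _ _)))
  have hβmin : klBetaMin ≤ β := klBetaMin_le_of_exp_le hU hUle (min_le_right _ _) hβa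
  have hβpos : 0 < β := pos_of_klBetaMin_le hβmin
  have hKL : ∀ n ≤ nScales β, IsKLRegime U c (-(n : ℤ)) := fun n hn =>
    isKLRegime_of_le_tempScaleIdx hc.le hβpos hβc hn
  -- child 4, with the thresholds of children 3, 1, 2 maxed
  refine h₄main μ hμ' U hU hU4 β hβmin hβc (max (Q.L0 β) (max (L₁ β U) (L₂ β U)))
    (fun L => max (Q.M0 β L) (M₂ β L)) ?_ x y σ σ'
  intro L M _ _ hL hM
  have hL0 : Q.L0 β ≤ L := (le_max_left _ _).trans hL
  have hL1 : L₁ β U ≤ L := ((le_max_left _ _).trans (le_max_right _ _)).trans hL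
  have hL2 : L₂ β U ≤ L := ((le_max_right _ _).trans (le_max_right _ _)).trans hL
  have hM0 : Q.M0 β L ≤ M := (le_max_left _ _).trans hM
  have hM2 : M₂ β L ≤ M := (le_max_right _ _).trans hM
  -- the glued induction (children 3 + 1) for EVERY admissible frame
  have hall : ∀ K : TrigPolyC4v, FrameOK R U (nScales β) μ K →
      ∀ n : ℕ, n ≤ nScales β → IsKLRegime U c (-(n : ℤ)) →
        (∀ j < n, RenormalisedAt L M β U μ K R j) →
          EngineBoundsAt L M G P Q β U μ K n ∧ TwoLegStepAt L M G P Q R β U μ K n ∧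
            BetaSplitAt L M G P Q β U μ K n := by
    intro K hK n hn _ hRn
    exact allScales_of_steps (KL := fun n => IsKLRegime U c (-(n : ℤ)))
      (fun n hn hkl hyp => h₃main μ hμ' U hU hU3 β hβmin hβc L M hL0 hM0 K hK n hn hkl hyp)
      (fun n hn hkl hyp hEn => h₁main μ hμ' U hU hU1 β hβmin hβc L M hL0 hL1 hM0 K hK n hn hkl hyp hEn)
      hKL n hn hRn
  -- child 2: the renormalised admissible frame
  obtain ⟨K, hK, hKR⟩ := h₂main μ hμ' U hU hU2 β hβmin hβc L M hL2 hM2 hall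
  refine ⟨K, hK, fun n hn => ?_⟩
  have h := hall K hK n hn (hKL n hn) fun j hj => hKR j (le_of_lt (lt_of_lt_of_le hj hn))
  exact ⟨hKR n hn, h.2.2, h.1, h.2.1⟩

/-- Window monotonicity of the `μ`-parametrised statement (as in the birth skeleton). -/
theorem KLRegimeTwoPointLimitMu_mono {μa μb μa' μb' : ℝ} (ha : μa ≤ μa') (hb : μb' ≤ μb) :
    KLRegimeTwoPointLimitMu μa μb → KLRegimeTwoPointLimitMu μa' μb' := by
  intro H a hapos
  obtain ⟨U₀, c, hU₀, hc, H'⟩ := H a hapos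
  refine ⟨U₀, c, hU₀, hc, ?_⟩
  intro μ hμ U β hU hUle hβle hβle' x y σ σ'
  exact H' μ ⟨ha.trans hμ.1, hμ.2.trans hb⟩ U β hU hUle hβle hβle' x y σ σ'

/-- **The crux modulo S0, from the four children**: with `μ(δ) ∈ [-1, -0.15]` for `δ ∈ [0.10, 0.35]` (S0 `MuOfDopingWindow`,
stated structurally to keep this module free of the route file) the four children give `KLRegimeTwoPointLimit`'s body. -/
theorem klRegimeTwoPointLimit_of_children (h₃ : KLRegimeEngine) (h₁ : KLRegimeBetaSplit) (h₂ : KLRegimeCounterterm)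
    (h₄ : KLRegimeTwoPointAssembly)
    (hS0 : ∀ δ ∈ Set.Icc (0.10 : ℝ) 0.35,
      chemicalPotentialOfDensity (squareDispersion 1 0) (1 - δ) ∈ Set.Icc (-1 : ℝ) (-0.15)) :
    ∀ a : ℝ, 0 < a → ∃ U₀ c : ℝ, 0 < U₀ ∧ 0 < c ∧ ∀ δ ∈ Set.Icc (0.10 : ℝ) 0.35, ∀ U β : ℝ, 0 < U → U ≤ U₀ →
      Real.exp (a / U) ≤ β → β ≤ Real.exp (c / U ^ 2) → ∀ (x y : Site 2) (σ σ' : Fin 2), ∃ S : ℂ,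
        Tendsto (fun L : ℕ => hubbardThermalTwoPoint β U
          (chemicalPotentialOfDensity (squareDispersion 1 0) (1 - δ)) L x y σ σ') atTop (nhds S) := by
  intro a ha
  obtain ⟨U₀, c, hU₀, hc, H⟩ := klRegime_induction h₃ h₁ h₂ h₄ a ha
  exact ⟨U₀, c, hU₀, hc, fun δ hδ U β hU hUle hβ hβ' x y σ σ' => H _ (hS0 δ hδ) U β hU hUle hβ hβ' x y σ σ'⟩

end Summit.HubbardSuperconductivity.HubbardSuperconductivity.Theorems.KLRegimeSplit

end
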